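import Mathlib
import Literature.MathematicalPhysics.QuantumFieldTheory.MirrorRPKernel
import Summits.CriticalPhenomena.Ising3DConformalLimit.Theses.UnitLightCone

/-!
# Sketch — crux-ideate round 1, ideator 2, crux `UnitSpeedTwoPoint` (stmt-CriticalPhenomena-17167)

First-lemma signatures of the two crux idea cards (statements as `def … : Prop`, plus the
sorry-free compositions showing how they feed the registered lines).  Nothing here is a stub
registration; the crux-plan seat types the skeletons.

* Card `boost-the-shell`: `BoostGeneratorIdentity`, `ShellRadial`, `ShellAxis`
  (⇒ Sommerfeld–Weyl = stub B of line `yukawa_subordination`), and the direct-Δ packaging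
  `PowerShellRadial`, `PowerShellAxis`.
* Card `os-squeeze`: `ConeSqueeze` (model-blind), `SubluminalMomentGrowth`, `ExistsKLOfMirrorRP`
  (⇒ the conclusion shape of stub S2 of line `birth`).
-/

noncomputable section

namespace Summit.CriticalPhenomena.Ising3DConformalLimit.Cruxes.UnitSpeedTwoPoint.IdeasR1K2

open MeasureTheory

/-! ## Card `boost-the-shell` -/

/-- `Ω_m(k₁,k₂) = √(k₁² + k₂² + m²)`, the energy on the mass shell. -/
def Om (m k₁ k₂ : ℝ) : ℝ := Real.sqrt (k₁ ^ 2 + k₂ ^ 2 + m ^ 2)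

/-- The Sommerfeld–Weyl shell integral `h_m(a,b,t) = ∫_{ℝ²} cos(k₀ a + k₁ b) e^{-Ω t} / Ω d²k`,
`Ω = √(‖k‖² + m²)` — the integrand of stub B of line `yukawa_subordination`, verbatim. -/
def shellKernel (m a b t : ℝ) : ℝ :=
  ∫ k : EuclideanSpace ℝ (Fin 2),
    Real.cos (k 0 * a + k 1 * b) *
      (Real.exp (-(Real.sqrt (‖k‖ ^ 2 + m ^ 2) * t)) / Real.sqrt (‖k‖ ^ 2 + m ^ 2))

/-- FIRST LEMMA of `boost-the-shell` (pointwise generator identity = infinitesimal Lorentz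
invariance of `d²k/Ω`): the Euclidean rotation generator `t ∂_a − a ∂_t` applied to the mixed
kernel `cos(k₁a + k₂b) e^{-Ωt}/Ω` is the `k₁`-DERIVATIVE of `sin(k₁a + k₂b) e^{-Ωt}`.  Written as a
`HasDerivAt` in `k₁` whose value is `t·(∂_a of the cosine kernel) − a·(∂_t of the cosine kernel)`
computed by hand. Pure calculus (`HasDerivAt.mul`, `Real.hasDerivAt_sqrt`, `ring`). -/
def BoostGeneratorIdentity : Prop :=
  ∀ m a b t k₂ k₁ : ℝ, 0 < k₁ ^ 2 + k₂ ^ 2 + m ^ 2 →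
    HasDerivAt (fun x : ℝ => Real.sin (x * a + k₂ * b) * Real.exp (-(Om m x k₂ * t)))
      (t * (-(k₁ * Real.sin (k₁ * a + k₂ * b)) * Real.exp (-(Om m k₁ k₂ * t)) / Om m k₁ k₂)
        - a * (-(Real.cos (k₁ * a + k₂ * b)) * Real.exp (-(Om m k₁ k₂ * t))))
      k₁

/-- The generator identity holds (pure calculus; proved here so that the card's first lemma is
not only typed but checked). -/
theorem boostGeneratorIdentity_proof : BoostGeneratorIdentity := by
  intro m a b t k₂ k₁ hpos
  have hΩ : 0 < Om m k₁ k₂ := Real.sqrt_pos.mpr hpos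
  have hΩ' : Om m k₁ k₂ ≠ 0 := hΩ.ne'
  have h1 : HasDerivAt (fun x : ℝ => x * a + k₂ * b) a k₁ := by
    simpa using ((hasDerivAt_id k₁).mul_const a).add_const (k₂ * b)
  have hsin : HasDerivAt (fun x : ℝ => Real.sin (x * a + k₂ * b))
      (Real.cos (k₁ * a + k₂ * b) * a) k₁ :=
    (Real.hasDerivAt_sin _).comp k₁ h1
  have hq : HasDerivAt (fun x : ℝ => x ^ 2 + k₂ ^ 2 + m ^ 2) (2 * k₁) k₁ := by
    have := ((hasDerivAt_pow 2 k₁).add_const (k₂ ^ 2)).add_const (m ^ 2)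
    simpa using this
  have hOm : HasDerivAt (fun x : ℝ => Om m x k₂) (2 * k₁ / (2 * Om m k₁ k₂)) k₁ :=
    hq.sqrt hpos.ne'
  have hexp : HasDerivAt (fun x : ℝ => Real.exp (-(Om m x k₂ * t)))
      (Real.exp (-(Om m k₁ k₂ * t)) * (-(2 * k₁ / (2 * Om m k₁ k₂) * t))) k₁ :=
    (Real.hasDerivAt_exp _).comp k₁ ((hOm.mul_const t).neg)
  have key : HasDerivAt (fun x : ℝ => Real.sin (x * a + k₂ * b) * Real.exp (-(Om m x k₂ * t)))
      (Real.cos (k₁ * a + k₂ * b) * a * Real.exp (-(Om m k₁ k₂ * t)) +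
        Real.sin (k₁ * a + k₂ * b) *
          (Real.exp (-(Om m k₁ k₂ * t)) * -(2 * k₁ / (2 * Om m k₁ k₂) * t))) k₁ :=
    hsin.mul hexp
  refine key.congr_deriv ?_
  field_simp
  ring

/-- Radiality of the shell integral on the open half-space `t > 0` (from the generator identity:
`(t∂_a − a∂_t) h_m = ∫ dk₂ ∫ ∂_{k₁}[…] dk₁ = 0` by Fubini + FTC with `e^{-Ωt}` decay, the same in `b`,
then constancy along the rotation arcs `θ ↦ (r sin θ ê, r cos θ)`, `|θ| < π/2`). -/
def ShellRadial : Prop :=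
  ∀ m a b t : ℝ, 0 ≤ m → 0 < t →
    shellKernel m a b t = shellKernel m 0 0 (Real.sqrt (a ^ 2 + b ^ 2 + t ^ 2))

/-- Axis evaluation: `h_m(0,0,r) = ∫ e^{-Ωr}/Ω d²k = 2π ∫₀^∞ e^{-√(κ²+m²) r} κ/√(κ²+m²) dκ
= 2π ∫_m^∞ e^{-u r} du = 2π e^{-mr}/r` (polar coordinates for a RADIAL integrand + one substitution /
the antiderivative `-e^{-√(κ²+m²) r}/r`). -/
def ShellAxis : Prop :=
  ∀ m r : ℝ, 0 ≤ m → 0 < r → shellKernel m 0 0 r = 2 * Real.pi * Real.exp (-(m * r)) / r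

/-- The two first lemmas give the Sommerfeld–Weyl evaluation (= the identity part of stub B of
`yukawa_subordination`, for `t > 0`; `t < 0` by evenness of the integrand in `t ↦ |t|`). -/
theorem sommerfeldWeyl_of (h1 : ShellRadial) (h2 : ShellAxis) :
    ∀ m a b t : ℝ, 0 ≤ m → 0 < t →
      shellKernel m a b t =
        2 * Real.pi * Real.exp (-(m * Real.sqrt (a ^ 2 + b ^ 2 + t ^ 2))) /
          Real.sqrt (a ^ 2 + b ^ 2 + t ^ 2) := by
  intro m a b t hm ht
  have hr : 0 < Real.sqrt (a ^ 2 + b ^ 2 + t ^ 2) := Real.sqrt_pos.mpr (by positivity)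
  rw [h1 m a b t hm ht, h2 m _ hm hr]

/-- Direct-Δ packaging (merges stubs A and B of `yukawa_subordination`): the power-law shell
integral `F_Δ(a,b,t) = ∫_{ℝ² × (0,∞)} cos(k₀a + k₁b) e^{-Ω_m t} m^{2Δ-2}/Ω_m d²k dm`. -/
def powerShell (Δ a b t : ℝ) : ℝ :=
  ∫ q : EuclideanSpace ℝ (Fin 2) × ℝ in Set.univ ×ˢ Set.Ioi 0,
    Real.cos (q.1 0 * a + q.1 1 * b) *
      (Real.exp (-(Real.sqrt (‖q.1‖ ^ 2 + q.2 ^ 2) * t)) * q.2 ^ (2 * Δ - 2) /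
        Real.sqrt (‖q.1‖ ^ 2 + q.2 ^ 2))

/-- Radiality of `F_Δ` (same generator identity, Fubini over `(k₂, m)`), `Δ > 1/2`. -/
def PowerShellRadial : Prop :=
  ∀ Δ a b t : ℝ, 1 / 2 < Δ → 0 < t →
    powerShell Δ a b t = powerShell Δ 0 0 (Real.sqrt (a ^ 2 + b ^ 2 + t ^ 2))

/-- Axis value of `F_Δ`: `2π ∫₀^∞ m^{2Δ-2} e^{-mr}/r dm = 2π Γ(2Δ-1) r^{-2Δ}`. -/
def PowerShellAxis : Prop :=
  ∀ Δ r : ℝ, 1 / 2 < Δ → 0 < r →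
    powerShell Δ 0 0 r = 2 * Real.pi * Real.Gamma (2 * Δ - 1) * r ^ (-(2 * Δ))

/-! ## Card `os-squeeze` -/

/-- FIRST LEMMA of `os-squeeze` (cone squeeze, model-blind): a positive measure on `ℝ² × [0,∞)`
whose exponential moments along every sub-luminal ray `(αe, 1)`, `‖e‖ = 1`, `0 ≤ α < 1`, grow at
most polynomially in `t` is carried by the closed forward cone `{ω ≥ ‖k‖}`.  Proof: on
`A = {α⟪e,k⟫ − ω ≥ ε}` the integrand is `≥ e^{tε}`, so `μ A · e^{tε} ≤ C t^p` forces `μ A = 0`;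
`{ω < ‖k‖}` is a countable union of such `A` (dense countable `e`, rational `α, ε`). -/
def ConeSqueeze : Prop :=
  ∀ (μ : Measure (EuclideanSpace ℝ (Fin 2) × ℝ)) (p : ℝ),
    μ {q | q.2 < 0} = 0 →
    (∀ (e : EuclideanSpace ℝ (Fin 2)) (α : ℝ), ‖e‖ = 1 → 0 ≤ α → α < 1 →
      ∃ C : ℝ, ∀ t : ℝ, 1 ≤ t →
        ∫⁻ q, ENNReal.ofReal (Real.exp (t * (α * inner ℝ e q.1 - q.2))) ∂μ ≤
          ENNReal.ofReal (C * t ^ p)) →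
    μ {q | q.2 < ‖q.1‖} = 0

/-- Moment growth for the explicit kernel (the only place the formula `C r^{-2Δ}` enters card 2):
if `μ ≥ 0` on `ℝ² × [0,∞)` represents `C (a²+b²+t²)^{-Δ}` in the frame, then its sub-luminal
exponential moments are `O(t^{-2Δ})`.  Proof: push `e^{-ωt}μ` forward under `k ↦ ⟪e,k⟫`; even
moments `∫ ⟪e,k⟫^{2n} e^{-ωt} dμ ≤ |∂_s^{2n} C(s²+t²)^{-Δ}|_{s=0}| = C t^{-2Δ-2n} (2n)! |binom(-Δ,n)|
≤ C t^{-2Δ-2n}(2n)!` (symmetric finite differences + Fatou; `|binom(-Δ,n)| ≤ 1` for `0 < Δ ≤ 1`);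
sum the cosh series: `∫ e^{αt⟪e,k⟫ - ωt} dμ ≤ 2C t^{-2Δ}/(1-α²)`. -/
def SubluminalMomentGrowth : Prop :=
  ∀ (μ : Measure (EuclideanSpace ℝ (Fin 2) × ℝ)) (C Δ : ℝ), 0 < C → 0 < Δ → Δ ≤ 1 →
    μ {q | q.2 < 0} = 0 →
    (∀ t a b : ℝ, t ≠ 0 →
      C * (a ^ 2 + b ^ 2 + t ^ 2) ^ (-Δ) =
        ∫ q, Real.cos (q.1 0 * a + q.1 1 * b) * Real.exp (-(q.2 * |t|)) ∂μ) →
    ∀ (e : EuclideanSpace ℝ (Fin 2)) (α : ℝ), ‖e‖ = 1 → 0 ≤ α → α < 1 →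
      ∃ C' : ℝ, ∀ t : ℝ, 1 ≤ t →
        ∫⁻ q, ENNReal.ofReal (Real.exp (t * (α * inner ℝ e q.1 - q.2))) ∂μ ≤
          ENNReal.ofReal (C' * t ^ (-(2 * Δ)))

/-- Existence stub of card 2 (Euclidean two-point reconstruction in ONE frame = BCR theorem on the
*-semigroup `ℝ² × (0,∞)`): an even kernel on `ℝ³`, continuous off `0`, bounded on slabs, invariant
and reflection positive for the mirror `e₂^⊥` (tree notion `IsMirrorRPKernel`, the shape of the
landed `hmirror` clause of `TwoPointKernelOfLimit`) has a positive Källén–Lehmann measure on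
`ℝ² × [0,∞)` in that frame — NO cone condition.  Inputs: tree Bochner (`bochner_holds`) in the
transverse variable, a measure form of Bernstein–Widder (from the tree's Hausdorff moment theorem)
in `t`, and the assembly of the joint measure. -/
def ExistsKLOfMirrorRP : Prop :=
  ∀ K : EuclideanSpace ℝ (Fin 3) → ℝ,
    ContinuousOn K {0}ᶜ → (∀ x, K (-x) = K x) →
    (∀ x, K (((ℝ ∙ (EuclideanSpace.single 2 (1:ℝ) : EuclideanSpace ℝ (Fin 3)))ᗮ).reflection x) = K x) →
    Literature.MathematicalPhysics.QuantumFieldTheory.IsMirrorRPKernel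
      (EuclideanSpace.single 2 (1:ℝ) : EuclideanSpace ℝ (Fin 3)) K →
    (∀ t₀ : ℝ, 0 < t₀ → ∃ M : ℝ, ∀ x : EuclideanSpace ℝ (Fin 3), t₀ ≤ x 2 → |K x| ≤ M) →
    ∃ μ : Measure (EuclideanSpace ℝ (Fin 2) × ℝ), μ {q | q.2 < 0} = 0 ∧
      ∀ t a b : ℝ, t ≠ 0 →
        K (EuclideanSpace.single 0 a + EuclideanSpace.single 1 b + EuclideanSpace.single 2 t) =
          ∫ q, Real.cos (q.1 0 * a + q.1 1 * b) * Real.exp (-(q.2 * |t|)) ∂μ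

/-- Card 2 composes to the conclusion shape of stub S2 of line `birth` (`stub_unitConeKLPowerLaw`):
un-coned existence + moment growth + squeeze ⇒ unit-cone representation. -/
theorem conedKL_of_squeeze (hS : ConeSqueeze) (hG : SubluminalMomentGrowth) {C Δ : ℝ}
    (hC : 0 < C) (hΔ0 : 0 < Δ) (hΔ1 : Δ ≤ 1)
    (hE : ∃ μ : Measure (EuclideanSpace ℝ (Fin 2) × ℝ), μ {q | q.2 < 0} = 0 ∧
      ∀ t a b : ℝ, t ≠ 0 →
        C * (a ^ 2 + b ^ 2 + t ^ 2) ^ (-Δ) =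
          ∫ q, Real.cos (q.1 0 * a + q.1 1 * b) * Real.exp (-(q.2 * |t|)) ∂μ) :
    ∃ μ : Measure (EuclideanSpace ℝ (Fin 2) × ℝ), μ {q | q.2 < ‖q.1‖} = 0 ∧
      ∀ t a b : ℝ, t ≠ 0 →
        C * (a ^ 2 + b ^ 2 + t ^ 2) ^ (-Δ) =
          ∫ q, Real.cos (q.1 0 * a + q.1 1 * b) * Real.exp (-(q.2 * |t|)) ∂μ := by
  obtain ⟨μ, hμ0, hμ⟩ := hE
  exact ⟨μ, hS μ (-(2 * Δ)) hμ0 (hG μ C Δ hC hΔ0 hΔ1 hμ0 hμ), hμ⟩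

end Summit.CriticalPhenomena.Ising3DConformalLimit.Cruxes.UnitSpeedTwoPoint.IdeasR1K2

end
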